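import Summits.CriticalPhenomena.CardyFormulaZ2.Theorems.CardyIKTransportIKLinearTransportStubCutMarkovKernelKernel

/-!
# Stub `stub_CutMarkovKernel` (K) — THE CUT-MARKOV PROPERTY of the diagram-conditioned middle column

`--supports stmt-CriticalPhenomena-5076`; proves the registered stub `stub_CutMarkovKernel` BY NAME.

THE KERNEL IDENTITY of the cut-Markov kernel `cmkK` (`cmk_kernel_law`): for every measurable set `A` of values
of the row statistic and every row value `y`,
`νmix T {rowStat ∈ A, rowBool = y} = ∫⁻_{rowStat ∈ A} cmkK (rowStat x) y`. Partition `A` by the last cut row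
`c = cmkCstar` of the environment. On `{c = 0}` the kernel IS a conditional distribution given the row
statistic (`setLIntegral_preimage_condDistrib`). On `{c ≤ -1}`: write `νmix T` as the image of three
independent samples (lower data, shared data supported on the shared coordinates, upper noise) under the
glued cut-adapted configuration (`cmk_nuMix_eq_map_glue3`, `cmk_glue3_pr`); by the factorisation of the strip
diagram across the cut (`cmk_key` facts of `…StubCutMarkovKernelDerived.lean`) the indicator
`1{rowStat ∈ A}` is a measurable weight of (lower sample, shared sample, UPPER STATISTIC, rows `(c,0)`), so
the abstract sufficiency lemma `cmk_abstract_sufficiency` replaces `1{row 0 = y}` by the upper conditional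
distribution `cmkKer`, whose argument is then READ OFF the row statistic (`cmkΓ`, `cmkPi2'`, `cmkTrunc`) —
which is `cmkK`. Together with `cmk_kernel_measurable/nonneg/sum_one/reads` this is `CutMarkovKernel S i (cmkK …)`.
-/

noncomputable section

namespace Summit.CriticalPhenomena.CardyFormulaZ2.Theorems.IKLinearTransport.PinnedDiagramExchange

open scoped Classical MeasureTheory ENNReal ProbabilityTheory symmDiff
open Set MeasureTheory ProbabilityTheory
open Literature.Probability.Percolation Literature.Probability.LatticeModels

section Law

variable (i : ℤ) (T : Set ℤ) (hT : i ∈ T ↔ i + 1 ∉ T)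

/-- THE LAW ON THE PIECE WITHOUT A CUT: there the kernel is a conditional distribution given the row statistic. [folklore] -/
theorem cmk_law_zero (A' : Set ((Obs × Set (Site 2 × Site 2)) × Obs)) (hA' : MeasurableSet A')
    (hsub : A' ⊆ {t | cmkCstar i t.1 = 0}) (y : Bool × Bool × Bool) :
    νmix T {x | rowStat i x ∈ A' ∧ rowBool i x = y} =
      ∫⁻ x in rowStat i ⁻¹' A', ENNReal.ofReal (cmkK i T (rowStat i x) y) ∂(νmix T) := by
  haveI := isProbabilityMeasure_nuMix T
  have hcongr : EqOn (fun x => ENNReal.ofReal (cmkK i T (rowStat i x) y)) (fun x => cmkK0 i T (rowStat i x) {y}) (rowStat i ⁻¹' A') := by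
    intro x hx
    have h0 : cmkCstar i (rowStat i x).1 = 0 := hsub hx
    simp only [cmkK, cmkKf, h0, if_true, ENNReal.ofReal_toReal (measure_ne_top _ _)]
  rw [setLIntegral_congr_fun ((measurable_rowStat i) hA') hcongr, cmkK0,
    setLIntegral_preimage_condDistrib (measurable_rowStat i) (measurable_rowBool i).aemeasurable (measurableSet_singleton y) hA']
  rfl

include hT

/-- THE LAW ON THE PIECE WITH LAST CUT ROW `c ≤ -1`. [folklore] -/
theorem cmk_law_neg (c : ℤ) (hc : c ≤ -1) (A' : Set ((Obs × Set (Site 2 × Site 2)) × Obs)) (hA' : MeasurableSet A')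
    (hsub : A' ⊆ {t | cmkCstar i t.1 = c}) (y : Bool × Bool × Bool) :
    νmix T {x | rowStat i x ∈ A' ∧ rowBool i x = y} =
      ∫⁻ x in rowStat i ⁻¹' A', ENNReal.ofReal (cmkK i T (rowStat i x) y) ∂(νmix T) := by
  haveI := isProbabilityMeasure_nuMix T
  -- the three-sample representation, with the shared sample projected onto the shared coordinates
  set P3' : Measure (SDE.KJ × SDE.KJ × SDE.KJ) := SDE.PJ.prod (cmkμ2 i T c) with hP3'
  set π : SDE.KJ × SDE.KJ × SDE.KJ → SDE.KJ × SDE.KJ × SDE.KJ := fun p => (p.1, cmkPr i (decide (i ∈ T)) c p.2.1, p.2.2) with hπdef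
  have hπm : Measurable π :=
    measurable_fst.prodMk (((cmk_measurable_pr i (decide (i ∈ T)) c).comp (measurable_fst.comp measurable_snd)).prodMk (measurable_snd.comp measurable_snd))
  have hconfm : Measurable (cmkConf i T c) := cmk_measurable_conf i T c
  have hP3'eq : P3' = cmkP3.map π := by
    rw [hP3', cmkP3, cmkμ2, show π = Prod.map id (Prod.map (cmkPr i (decide (i ∈ T)) c) id) from rfl,
      ← Measure.map_prod_map _ _ measurable_id ((cmk_measurable_pr i (decide (i ∈ T)) c).prodMap measurable_id), Measure.map_id,
      ← Measure.map_prod_map _ _ (cmk_measurable_pr i (decide (i ∈ T)) c) measurable_id, Measure.map_id]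
  have hconfπ : cmkConf i T c ∘ π = cmkConf i T c := by
    funext p; exact congrArg (cmkΞ i T c) (cmk_glue3_pr i (decide (i ∈ T)) c p.1 p.2.1 p.2.2)
  have hν : νmix T = P3'.map (cmkConf i T c) := by
    rw [hP3'eq, Measure.map_map hconfm hπm, hconfπ]; exact cmk_nuMix_eq_map_glue3 i T c
  -- the integrands
  set Kf : cmkStatSp → ℝ≥0∞ := fun s => cmkKer i T c s {y} with hKf
  set G : SDE.KJ × SDE.KJ × (Set (Site 2 × Site 2) × Prop × Prop) × Obs → ℝ≥0∞ := fun q =>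
    if cmkC i c (cmkLconf i T c (q.1, q.2.1)) q.2.2.1 then A'.indicator 1 (cmkRS i c (cmkLconf i T c (q.1, q.2.1)) q.2.2.1 q.2.2.2) else 0
    with hG
  set F₁ : SDE.KJ × SDE.KJ × SDE.KJ → ℝ≥0∞ := fun p =>
    A'.indicator 1 (rowStat i (cmkConf i T c p)) * ({y} : Set (Bool × Bool × Bool)).indicator 1 (rowBool i (cmkConf i T c p)) with hF₁
  set F₂ : SDE.KJ × SDE.KJ × SDE.KJ → ℝ≥0∞ := fun p =>
    G (p.1, p.2.1, cmkUst i T c p.2, cmkV i T c p.2) * ((fun p : SDE.KJ × SDE.KJ × SDE.KJ => cmkY i T c p.2) ⁻¹' {y}).indicator 1 p with hF₂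
  set F₃ : SDE.KJ × SDE.KJ × SDE.KJ → ℝ≥0∞ := fun p =>
    G (p.1, p.2.1, cmkUst i T c p.2, cmkV i T c p.2) * Kf (p.2.1, cmkUst i T c p.2, cmkV i T c p.2) with hF₃
  set F₄ : SDE.KJ × SDE.KJ × SDE.KJ → ℝ≥0∞ := fun p =>
    A'.indicator 1 (rowStat i (cmkConf i T c p)) * ENNReal.ofReal (cmkK i T (rowStat i (cmkConf i T c p)) y) with hF₄
  obtain ⟨hYm, hVm, hUm⟩ := cmk_measurable_upper i T c
  have hKfm : Measurable Kf := (cmkKer i T c).measurable_coe (measurableSet_singleton y)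
  have hGm : Measurable G := by
    have hl : Measurable fun q : SDE.KJ × SDE.KJ × (Set (Site 2 × Site 2) × Prop × Prop) × Obs => cmkLconf i T c (q.1, q.2.1) :=
      (cmk_measurable_lconf i T c).comp (measurable_fst.prodMk (measurable_fst.comp measurable_snd))
    refine Measurable.ite ?_ ((measurable_one.indicator hA').comp ((cmk_measurable_RS i c).comp
      (hl.prodMk ((measurable_fst.comp (measurable_snd.comp measurable_snd)).prodMk (measurable_snd.comp (measurable_snd.comp measurable_snd))))))
      measurable_const
    exact measurableSet_setOf.2 ((cmk_measurable_C i c).comp (hl.prodMk (measurable_fst.comp (measurable_snd.comp measurable_snd))))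
  have hstat : Measurable fun p : SDE.KJ × SDE.KJ × SDE.KJ => (p.1, p.2.1, cmkUst i T c p.2, cmkV i T c p.2) :=
    measurable_fst.prodMk ((measurable_fst.comp measurable_snd).prodMk ((hUm.comp measurable_snd).prodMk (hVm.comp measurable_snd)))
  have hF₃m : Measurable F₃ := (hGm.comp hstat).mul (hKfm.comp ((measurable_fst.comp measurable_snd).prodMk
    ((hUm.comp measurable_snd).prodMk (hVm.comp measurable_snd))))
  have hF₄m' : Measurable fun x : Obs => (rowStat i ⁻¹' A').indicator (fun x => ENNReal.ofReal (cmkK i T (rowStat i x) y)) x :=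
    (((cmk_kernel_measurable i T y).comp (measurable_rowStat i)).ennreal_ofReal).indicator ((measurable_rowStat i) hA')
  have hF₄m : Measurable F₄ :=
    ((measurable_one.indicator hA').comp ((measurable_rowStat i).comp hconfm)).mul
      (((cmk_kernel_measurable i T y).comp ((measurable_rowStat i).comp hconfm)).ennreal_ofReal)
  -- membership in `A'` forces the cut at `c`
  have hcutA : ∀ x : Obs, rowStat i x ∈ A' → IsCut i c (pinnedStat i x) := fun x hx => cmk_isCut_of_cstar i hc (hsub hx)
  -- (PI-1)
  have hPI1 : ∀ p, F₁ p = F₂ p := by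
    rintro ⟨a, θ, b⟩
    have hY := (cmk_conf_Y_V i c hT hc a θ b).1
    simp only [hF₁, hF₂, hG]
    by_cases hcut : IsCut i c (pinnedStat i (cmkConf i T c (a, θ, b)))
    · rw [if_pos ((cmk_conf_isCut_iff i c hT hc a θ b).1 hcut), (cmk_conf_cut i c hT hc a θ b hcut).1]
      simp only [indicator, mem_preimage, mem_singleton_iff, Pi.one_apply, hY]
    · rw [if_neg (fun h => hcut ((cmk_conf_isCut_iff i c hT hc a θ b).2 h)), zero_mul,
        indicator_of_notMem (fun h => hcut (hcutA _ h)), zero_mul]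
  -- (PI-2), at a projected shared sample
  have hPI2 : ∀ p, F₃ (π p) = F₄ (π p) := by
    rintro ⟨a, θ, b⟩
    have hθ : cmkPr i (decide (i ∈ T)) c (cmkPr i (decide (i ∈ T)) c θ) = cmkPr i (decide (i ∈ T)) c θ := cmk_pr_pr i (decide (i ∈ T)) c θ
    simp only [hF₃, hF₄, hG, hπdef]
    by_cases hcut : IsCut i c (pinnedStat i (cmkConf i T c (a, cmkPr i (decide (i ∈ T)) c θ, b)))
    · rw [if_pos ((cmk_conf_isCut_iff i c hT hc _ _ _).1 hcut), (cmk_conf_cut i c hT hc _ _ _ hcut).1]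
      by_cases hA : rowStat i (cmkConf i T c (a, cmkPr i (decide (i ∈ T)) c θ, b)) ∈ A'
      · have hcs : cmkCstar i (rowStat i (cmkConf i T c (a, cmkPr i (decide (i ∈ T)) c θ, b))).1 = c := hsub hA
        have hne : c ≠ 0 := by omega
        have hU := (cmk_conf_cut i c hT hc _ _ _ hcut).2
        have hV := (cmk_conf_Y_V i c hT hc a (cmkPr i (decide (i ∈ T)) c θ) b).2
        have hΓ := cmk_conf_gamma i c hT rfl a _ b hθ hcut
        congr 1
        rw [cmkK, hcs, cmkKf, if_neg hne, ENNReal.ofReal_toReal (measure_ne_top _ _), hKf, cmkRed]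
        dsimp only [rowStat, pinnedStat]
        rw [← hΓ, ← hU, hV]
      · rw [indicator_of_notMem hA, zero_mul, zero_mul]
    · rw [if_neg (fun h => hcut ((cmk_conf_isCut_iff i c hT hc _ _ _).2 h)), zero_mul,
        indicator_of_notMem (fun h => hcut (hcutA _ h)), zero_mul]
  -- the density identity of the upper conditional distribution
  have hdef : ∀ H : cmkStatSp → ℝ≥0∞, Measurable H →
      ∫⁻ ω, H (ω.1, cmkUst i T c ω, cmkV i T c ω) * ((cmkY i T c) ⁻¹' {y}).indicator (1 : SDE.KJ × SDE.KJ → ℝ≥0∞) ω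
          ∂((SDE.PJ.map (cmkPr i (decide (i ∈ T)) c)).prod SDE.PJ) =
        ∫⁻ ω, H (ω.1, cmkUst i T c ω, cmkV i T c ω) * Kf (ω.1, cmkUst i T c ω, cmkV i T c ω) ∂((SDE.PJ.map (cmkPr i (decide (i ∈ T)) c)).prod SDE.PJ) :=
    fun H hH => cmk_lintegral_condDistrib (cmkμ2 i T c) (cmk_measurable_X i T c) hYm (measurableSet_singleton y) hH
  -- the chain
  have step1 : νmix T {x | rowStat i x ∈ A' ∧ rowBool i x = y} = ∫⁻ p, F₁ p ∂P3' := by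
    have hS : MeasurableSet {x : Obs | rowStat i x ∈ A' ∧ rowBool i x = y} :=
      ((measurable_rowStat i) hA').inter ((measurable_rowBool i) (measurableSet_singleton y))
    rw [hν, Measure.map_apply hconfm hS, ← lintegral_indicator_one (hconfm hS)]
    refine lintegral_congr fun p => ?_
    simp only [hF₁, indicator, mem_preimage, mem_setOf_eq, mem_singleton_iff, Pi.one_apply]
    by_cases h1 : rowStat i (cmkConf i T c p) ∈ A' <;> by_cases h2 : rowBool i (cmkConf i T c p) = y <;> simp [h1, h2]
  have step3 : ∫⁻ p, F₂ p ∂P3' = ∫⁻ p, F₃ p ∂P3' :=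
    cmk_abstract_sufficiency SDE.PJ (SDE.PJ.map (cmkPr i (decide (i ∈ T)) c)) SDE.PJ (cmkUst i T c) (cmkV i T c) (cmkY i T c) y Kf
      hUm hVm hYm (measurableSet_singleton y) hKfm hdef G hGm
  have step4 : ∫⁻ p, F₃ p ∂P3' = ∫⁻ p, F₄ p ∂P3' := by
    rw [hP3'eq, lintegral_map hF₃m hπm, lintegral_map hF₄m hπm]
    exact lintegral_congr hPI2
  have step5 : ∫⁻ p, F₄ p ∂P3' = ∫⁻ x in rowStat i ⁻¹' A', ENNReal.ofReal (cmkK i T (rowStat i x) y) ∂(νmix T) := by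
    rw [← lintegral_indicator ((measurable_rowStat i) hA'), hν, lintegral_map hF₄m' hconfm]
    refine lintegral_congr fun p => ?_
    simp only [hF₄, indicator, mem_preimage, Pi.one_apply]
    by_cases h1 : rowStat i (cmkConf i T c p) ∈ A' <;> simp [h1]
  rw [step1, lintegral_congr hPI1, step3, step4, step5]

omit hT in
/-- Level sets of the last-cut function are measurable in the statistic value. [folklore] -/
theorem cmk_measurableSet_cstar_level (c : ℤ) : MeasurableSet {t : (Obs × Set (Site 2 × Site 2)) × Obs | cmkCstar i t.1 = c} :=
  ((cmk_measurable_cstar i).comp measurable_fst) (measurableSet_singleton c)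

/-- THE KERNEL IDENTITY OF THE CUT-MARKOV KERNEL. [folklore] -/
theorem cmk_kernel_law (A : Set ((Obs × Set (Site 2 × Site 2)) × Obs)) (hA : MeasurableSet A) (y : Bool × Bool × Bool) :
    νmix T {x | rowStat i x ∈ A ∧ rowBool i x = y} = ∫⁻ x in rowStat i ⁻¹' A, ENNReal.ofReal (cmkK i T (rowStat i x) y) ∂(νmix T) := by
  set Ac : ℤ → Set ((Obs × Set (Site 2 × Site 2)) × Obs) := fun c => A ∩ {t | cmkCstar i t.1 = c} with hAc
  have hAcm : ∀ c, MeasurableSet (Ac c) := fun c => hA.inter (cmk_measurableSet_cstar_level i c)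
  have hdisj : Pairwise (Function.onFun Disjoint fun c => rowStat i ⁻¹' Ac c) := fun c c' hne =>
    disjoint_left.2 fun x h1 h2 => hne (h1.2.symm.trans h2.2)
  have hdisj' : Pairwise (Function.onFun Disjoint fun c => {x : Obs | rowStat i x ∈ Ac c ∧ rowBool i x = y}) := fun c c' hne =>
    disjoint_left.2 fun x h1 h2 => hne (h1.1.2.symm.trans h2.1.2)
  have hU1 : {x : Obs | rowStat i x ∈ A ∧ rowBool i x = y} = ⋃ c, {x | rowStat i x ∈ Ac c ∧ rowBool i x = y} := by
    ext x; simp only [mem_setOf_eq, mem_iUnion, hAc, mem_inter_iff]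
    exact ⟨fun ⟨h1, h2⟩ => ⟨_, ⟨h1, rfl⟩, h2⟩, fun ⟨c, ⟨h1, _⟩, h2⟩ => ⟨h1, h2⟩⟩
  have hU2 : rowStat i ⁻¹' A = ⋃ c, rowStat i ⁻¹' Ac c := by
    ext x; simp only [mem_preimage, mem_iUnion, hAc, mem_inter_iff, mem_setOf_eq]
    exact ⟨fun h1 => ⟨_, h1, rfl⟩, fun ⟨c, h1, _⟩ => h1⟩
  rw [hU1, hU2, measure_iUnion hdisj' fun c => ((measurable_rowStat i) (hAcm c)).inter ((measurable_rowBool i) (measurableSet_singleton y)),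
    lintegral_iUnion (fun c => (measurable_rowStat i) (hAcm c)) hdisj]
  refine tsum_congr fun c => ?_
  by_cases hc : c ≤ -1
  · exact cmk_law_neg i T hT c hc (Ac c) (hAcm c) inter_subset_right y
  · by_cases hc0 : c = 0
    · subst hc0; exact cmk_law_zero i T (Ac 0) (hAcm 0) inter_subset_right y
    · have hempty : rowStat i ⁻¹' Ac c = ∅ := by
        ext x; simp only [mem_preimage, hAc, mem_inter_iff, mem_setOf_eq, mem_empty_iff_false, iff_false, not_and]
        intro _ h; exact hc0 ((cmk_cstar_eq_iff' i _ hc).1 h).1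
      have hempty' : {x : Obs | rowStat i x ∈ Ac c ∧ rowBool i x = y} = ∅ := by
        ext x; simp only [mem_setOf_eq, mem_empty_iff_false, iff_false, not_and]
        intro h; have : x ∈ rowStat i ⁻¹' Ac c := h; rw [hempty] at this; exact absurd this (notMem_empty x)
      rw [hempty, hempty', measure_empty, Measure.restrict_empty, lintegral_zero_measure]

/-- THE CUT-MARKOV KERNEL IS A CUT-MARKOV VERSION of the conditional row law. [folklore] -/
theorem cmk_cutMarkovKernel (S : Set ℤ) (hS : T = S ∆ {i, i + 1}) : CutMarkovKernel S i (cmkK i T) := by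
  subst hS
  exact { measurable := cmk_kernel_measurable i _
          nonneg := cmk_kernel_nonneg i _
          sum_one := cmk_kernel_sum_one i _
          reads := fun p z z' c hc hcut hz => cmk_kernel_reads i _ p z z' c hc hcut hz
          law := fun A hA b => cmk_kernel_law i _ hT A hA b }

end Law

/-- STUB `stub_CutMarkovKernel` (K) of the line `pinned-diagram-exchange` (crux stmt-CriticalPhenomena-5076): THE
CUT-MARKOV PROPERTY of the diagram-conditioned middle column — for admissible `(S, i)` there is a cut-Markov
version of the conditional law of the middle row `0` of `νmix (S ∆ {i,i+1})` given the row statistic. [folklore] -/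
theorem stub_CutMarkovKernel : ∀ (S : Set ℤ) (i : ℤ), (i ∈ S ↔ i + 1 ∉ S) → StripDiagramExchange S i → ∃ k : (Obs × Set (Site 2 × Site 2)) × Obs → Bool × Bool × Bool → ℝ, CutMarkovKernel S i k := by
  intro S i h _
  have hT : i ∈ S ∆ {i, i + 1} ↔ i + 1 ∉ S ∆ {i, i + 1} := by
    simp only [mem_symmDiff, mem_insert_iff, mem_singleton_iff]
    constructor <;> intro h1 <;> [skip; skip] <;> (first | omega | tauto)
  exact ⟨cmkK i (S ∆ {i, i + 1}), cmk_cutMarkovKernel i _ hT S rfl⟩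

end Summit.CriticalPhenomena.CardyFormulaZ2.Theorems.IKLinearTransport.PinnedDiagramExchange
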